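import Mathlib
import HarnessLib
import Summits.ValiantsHypothesis.ValiantsHypothesis.Theorems.LacunarySymmetroidMatrixDescartesProductPlusOneRiccati

/-!
# ValiantsHypothesis / LacunarySymmetroid — crux `MatrixDescartes` (stmt-ValiantsHypothesis-18050, V1),
# LINE (A) «product_plus_one», floor stub `OneChangeFloorK3`: the UP-CROSSING BUDGET of the incoherent cell

First quantitative interaction statement for the research floor (memo `pub/val-lit/lmr/NOTE-p7g15-18050-LINEA-incoherent-cell.md` §3 (iii)),
from the Riccati structure of ✓/⧗ `…ProductPlusOneRiccati`.  Setting: K = 3, support `(e, e+p, e+q)` with `0 < p ≤ q`, a point `x > 0`, `k` SWITCHED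
factors (`a·F(x) < 0`; risers — for the incoherent one-zero pattern `a c ≤ 0` their Euler ratios exceed `p`) and `M` UNSWITCHED incoherent factors (`a·F(x) > 0`, `a b ≤ 0`,
`a c ≤ 0`; `ψ_i = −Φ_i ≥ 0`, pullers).  The total Euler ratio `S = Σ_j Φ_j − Σ_i ψ_i` is (up to the nonvanishing factor `∏ F`) the c-free Euler
numerator of the member on the zero-free interval containing `x`, so an UP-CROSSING of `R` there is a point with `S(x) = 0 ≤ S′(x)`.

* ★ `upCrossing_budget` — at such a point `(Σ_j Φ_j)² ≤ M · Σ_j ((Φ_j − p)(q − Φ_j) − p Φ_j)` (aggregate riser/puller bounds + Cauchy–Schwarz);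
* ★ `upCrossing_level_le` — hence `(Σ_j Φ_j)² ≤ M·k·q(q − 4p)/4`: up-crossings only occur below the LEVEL CEILING `√(kM·q(q−4p))/2`, and
* ★ `no_upCrossing_of_few_pullers` — if `M·q(q−4p) < 4k·p²` (few pullers left), no up-crossing either; `eulerRatio_mem_band_of_rising` — a
  switched factor rises only inside the band `p < Φ < q`;
* ★ `no_upCrossing_of_tame_window` — in the tame window `q ≤ 4p` there is NO up-crossing with a positive pull (`Σ_j Φ_j > 0`): the tame theorem's
  mechanism isolated as a statement about the sum (each riser's slack `(Φ−p)(q−Φ) − pΦ ≤ q(q−4p)/4`).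

Honest framing: structure/calculus for the floor; it bounds WHERE up-crossings can sit, not HOW MANY there are; NOT `OneChangeFloorK3` /
`stub_classRowK3` / `stub_polyLaw` / `MatrixDescartes` / B; `VP ≠ VNP` NOT proved.  No definitions, no named facts.
-/

set_option linter.dupNamespace false

namespace Summit.ValiantsHypothesis.ValiantsHypothesis.Theorems.LacunarySymmetroidMatrixDescartes

namespace ProductPlusOne

open Polynomial Finset
open scoped BigOperators

/-- the riser slack is at most `q(q − 4p)/4`: `(Φ − p)(q − Φ) − pΦ ≤ q(q−4p)/4`. [folklore] -/
theorem riser_slack_le (p q Φ : ℝ) : (Φ - p) * (q - Φ) - p * Φ ≤ q * (q - 4 * p) / 4 := by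
  nlinarith [sq_nonneg (Φ - q / 2)]

/-- ★ **THE UP-CROSSING BUDGET.**  `k` switched incoherent factors (coefficients `as, bs, cs`), `M` unswitched ones (`au, bu, cu`) on the support
`(e, e+p, e+q)`, `0 < p ≤ q`, at `x > 0`; `S(y) = Σ_j Φ_j(y) + Σ_i Φ_i(y)` the total Euler ratio.  If `S(x) = 0` and `0 ≤ S′(x)` then
`(Σ_j Φ_j(x))² ≤ M · Σ_j ((Φ_j(x) − p)(q − Φ_j(x)) − p Φ_j(x))`. [this file's theorem] -/
theorem upCrossing_budget (k M : ℕ) (e p q : ℕ) (hpq : p ≤ q) (as bs cs : Fin k → ℝ) (au bu cu : Fin M → ℝ)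
    {x : ℝ} (hx : 0 < x)
    (hsw : ∀ j, as j * (as j * x ^ e + bs j * x ^ (e + p) + cs j * x ^ (e + q)) < 0)
    (hun : ∀ i, 0 < au i * (au i * x ^ e + bu i * x ^ (e + p) + cu i * x ^ (e + q)))
    (hub : ∀ i, au i * bu i ≤ 0) (huc : ∀ i, au i * cu i ≤ 0)
    (hzero : (∑ j, ((p : ℝ) * bs j * x ^ (e + p) + (q : ℝ) * cs j * x ^ (e + q)) / (as j * x ^ e + bs j * x ^ (e + p) + cs j * x ^ (e + q)))
      + (∑ i, ((p : ℝ) * bu i * x ^ (e + p) + (q : ℝ) * cu i * x ^ (e + q)) / (au i * x ^ e + bu i * x ^ (e + p) + cu i * x ^ (e + q))) = 0)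
    (hup : 0 ≤ deriv (fun y : ℝ =>
      (∑ j, ((p : ℝ) * bs j * y ^ (e + p) + (q : ℝ) * cs j * y ^ (e + q)) / (as j * y ^ e + bs j * y ^ (e + p) + cs j * y ^ (e + q)))
      + ∑ i, ((p : ℝ) * bu i * y ^ (e + p) + (q : ℝ) * cu i * y ^ (e + q)) / (au i * y ^ e + bu i * y ^ (e + p) + cu i * y ^ (e + q))) x) :
    (∑ j, ((p : ℝ) * bs j * x ^ (e + p) + (q : ℝ) * cs j * x ^ (e + q)) / (as j * x ^ e + bs j * x ^ (e + p) + cs j * x ^ (e + q))) ^ 2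
      ≤ (M : ℝ) * ∑ j, ((((p : ℝ) * bs j * x ^ (e + p) + (q : ℝ) * cs j * x ^ (e + q)) / (as j * x ^ e + bs j * x ^ (e + p) + cs j * x ^ (e + q)) - p)
          * (q - ((p : ℝ) * bs j * x ^ (e + p) + (q : ℝ) * cs j * x ^ (e + q)) / (as j * x ^ e + bs j * x ^ (e + p) + cs j * x ^ (e + q)))
        - p * (((p : ℝ) * bs j * x ^ (e + p) + (q : ℝ) * cs j * x ^ (e + q)) / (as j * x ^ e + bs j * x ^ (e + p) + cs j * x ^ (e + q)))) := by
  classical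
  -- names
  set Fs : Fin k → ℝ → ℝ := fun j y => as j * y ^ e + bs j * y ^ (e + p) + cs j * y ^ (e + q) with hFs
  set Ns : Fin k → ℝ → ℝ := fun j y => (p : ℝ) * bs j * y ^ (e + p) + (q : ℝ) * cs j * y ^ (e + q) with hNs
  set Fu : Fin M → ℝ → ℝ := fun i y => au i * y ^ e + bu i * y ^ (e + p) + cu i * y ^ (e + q) with hFu
  set Nu : Fin M → ℝ → ℝ := fun i y => (p : ℝ) * bu i * y ^ (e + p) + (q : ℝ) * cu i * y ^ (e + q) with hNu
  set Φ : Fin k → ℝ := fun j => Ns j x / Fs j x with hΦ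
  set ψ : Fin M → ℝ := fun i => -(Nu i x / Fu i x) with hψ
  have hFs0 : ∀ j, Fs j x ≠ 0 := fun j h => by have := hsw j; simp only [hFs] at h; rw [h, mul_zero] at this; exact lt_irrefl 0 this
  have hFu0 : ∀ i, Fu i x ≠ 0 := fun i h => by have := hun i; simp only [hFu] at h; rw [h, mul_zero] at this; exact lt_irrefl 0 this
  -- derivatives of each ratio (Riccati) and of the sum
  have hDs := fun j => hasDerivAt_eulerRatio (as j) (bs j) (cs j) e p q hx (hFs0 j)
  have hDu := fun i => hasDerivAt_eulerRatio (au i) (bu i) (cu i) e p q hx (hFu0 i)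
  have hsum0 := (HasDerivAt.fun_sum (u := Finset.univ) (fun j _ => hDs j)).add
    (HasDerivAt.fun_sum (u := Finset.univ) (fun i _ => hDu i))
  have hsum : HasDerivAt (fun y : ℝ =>
      (∑ j, ((p : ℝ) * bs j * y ^ (e + p) + (q : ℝ) * cs j * y ^ (e + q)) / (as j * y ^ e + bs j * y ^ (e + p) + cs j * y ^ (e + q)))
      + ∑ i, ((p : ℝ) * bu i * y ^ (e + p) + (q : ℝ) * cu i * y ^ (e + q)) / (au i * y ^ e + bu i * y ^ (e + p) + cu i * y ^ (e + q))) _ x :=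
    hsum0
  have hderiv_eq := hsum.deriv
  -- the value of the derivative, bounded above via the riser / puller bounds
  rw [hderiv_eq] at hup
  -- riser: drag ≤ 0 ; puller: −(RHS_i) ≥ ψ_i(ψ_i + p)
  have hris : ∀ j, (((Ns j x / Fs j x - p) * (q - Ns j x / Fs j x)) + (p : ℝ) * q * (as j * x ^ e / Fs j x)) / x
      ≤ ((Φ j - p) * (q - Φ j)) / x := by
    intro j
    have hd := drag_nonpos_of_switched (as j) (bs j) (cs j) e p q hx (hsw j)
    simp only [hFs] at hd ⊢
    exact div_le_div_of_nonneg_right (by linarith) hx.le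
  have hpul : ∀ i, (((Nu i x / Fu i x - p) * (q - Nu i x / Fu i x)) + (p : ℝ) * q * (au i * x ^ e / Fu i x)) / x
      ≤ -(ψ i * (ψ i + p)) / x := by
    intro i
    have hb := (puller_bound (au i) (bu i) (cu i) e p q hpq hx (hub i) (huc i) (hun i) (Nu i x / Fu i x) rfl).2
    simp only [hFu, hNu, hψ] at hb ⊢
    exact div_le_div_of_nonneg_right (by linarith) hx.le
  have hψnn : ∀ i, 0 ≤ ψ i := fun i =>
    (puller_bound (au i) (bu i) (cu i) e p q hpq hx (hub i) (huc i) (hun i) (Nu i x / Fu i x) rfl).1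
  -- sum the bounds
  have hS1 : (∑ j, (((Ns j x / Fs j x - p) * (q - Ns j x / Fs j x)) + (p : ℝ) * q * (as j * x ^ e / Fs j x)) / x)
      ≤ ∑ j, ((Φ j - p) * (q - Φ j)) / x := Finset.sum_le_sum fun j _ => hris j
  have hS2 : (∑ i, (((Nu i x / Fu i x - p) * (q - Nu i x / Fu i x)) + (p : ℝ) * q * (au i * x ^ e / Fu i x)) / x)
      ≤ ∑ i, -(ψ i * (ψ i + p)) / x := Finset.sum_le_sum fun i _ => hpul i
  have hsum0 : 0 ≤ (∑ j, ((Φ j - p) * (q - Φ j)) / x) + ∑ i, -(ψ i * (ψ i + p)) / x := by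
    have h := add_le_add hS1 hS2
    simp only [hFs, hNs, hFu, hNu] at h hup ⊢
    linarith
  -- clear the factor `1/x`
  have hsum1 : 0 ≤ (∑ j, (Φ j - p) * (q - Φ j)) - ∑ i, ψ i * (ψ i + p) := by
    have e1 : (∑ j, ((Φ j - p) * (q - Φ j)) / x) + ∑ i, -(ψ i * (ψ i + p)) / x
        = ((∑ j, (Φ j - p) * (q - Φ j)) - ∑ i, ψ i * (ψ i + p)) / x := by
      rw [← Finset.sum_div, ← Finset.sum_div, Finset.sum_neg_distrib]; ring
    rw [e1] at hsum0
    exact (div_nonneg_iff.1 hsum0).elim (fun h => h.1) (fun h => absurd h.2 (not_le.2 hx))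
  -- the zero condition: Σ Φ = Σ ψ
  have hN : ∑ j, Φ j = ∑ i, ψ i := by
    have : (∑ j, Φ j) + ∑ i, Nu i x / Fu i x = 0 := by simpa [hΦ, hFs, hNs, hFu, hNu] using hzero
    rw [hψ, Finset.sum_neg_distrib]; linarith
  -- Σ ψ(ψ+p) = Σ ψ² + p Σψ, and Cauchy–Schwarz (Σ ψ)² ≤ M Σ ψ²
  have hCS : (∑ i, ψ i) ^ 2 ≤ (M : ℝ) * ∑ i, ψ i ^ 2 := by
    have h := Finset.sum_mul_sq_le_sq_mul_sq Finset.univ (fun _ => (1 : ℝ)) ψ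
    simp only [one_pow, one_mul, Finset.sum_const, Finset.card_univ, Fintype.card_fin, nsmul_eq_mul, mul_one] at h
    exact h
  have hexp : ∑ i, ψ i * (ψ i + p) = (∑ i, ψ i ^ 2) + p * ∑ i, ψ i := by
    rw [Finset.mul_sum, ← Finset.sum_add_distrib]
    exact Finset.sum_congr rfl fun i _ => by ring
  have hM : (0 : ℝ) ≤ M := Nat.cast_nonneg M
  -- assemble: (Σψ)² ≤ M Σψ² ≤ M (Σ slack − pΣψ ) and Σψ = ΣΦ
  have hslack : ∑ i, ψ i ^ 2 ≤ ∑ j, ((Φ j - p) * (q - Φ j) - p * Φ j) := by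
    rw [Finset.sum_sub_distrib, ← Finset.mul_sum, hN]
    linarith
  have hgoal : (∑ j, Φ j) ^ 2 ≤ (M : ℝ) * ∑ j, ((Φ j - p) * (q - Φ j) - p * Φ j) := by
    rw [hN]
    exact hCS.trans (mul_le_mul_of_nonneg_left hslack hM)
  simpa [hΦ, hFs, hNs] using hgoal

/-- ★ **LEVEL CEILING**: under the hypotheses of `upCrossing_budget`, `(Σ_j Φ_j)² ≤ M·k·q(q − 4p)/4`. [this file's theorem] -/
theorem upCrossing_level_le (k M : ℕ) (e p q : ℕ) (hpq : p ≤ q) (as bs cs : Fin k → ℝ) (au bu cu : Fin M → ℝ)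
    {x : ℝ} (hx : 0 < x)
    (hsw : ∀ j, as j * (as j * x ^ e + bs j * x ^ (e + p) + cs j * x ^ (e + q)) < 0)
    (hun : ∀ i, 0 < au i * (au i * x ^ e + bu i * x ^ (e + p) + cu i * x ^ (e + q)))
    (hub : ∀ i, au i * bu i ≤ 0) (huc : ∀ i, au i * cu i ≤ 0)
    (hzero : (∑ j, ((p : ℝ) * bs j * x ^ (e + p) + (q : ℝ) * cs j * x ^ (e + q)) / (as j * x ^ e + bs j * x ^ (e + p) + cs j * x ^ (e + q)))
      + (∑ i, ((p : ℝ) * bu i * x ^ (e + p) + (q : ℝ) * cu i * x ^ (e + q)) / (au i * x ^ e + bu i * x ^ (e + p) + cu i * x ^ (e + q))) = 0)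
    (hup : 0 ≤ deriv (fun y : ℝ =>
      (∑ j, ((p : ℝ) * bs j * y ^ (e + p) + (q : ℝ) * cs j * y ^ (e + q)) / (as j * y ^ e + bs j * y ^ (e + p) + cs j * y ^ (e + q)))
      + ∑ i, ((p : ℝ) * bu i * y ^ (e + p) + (q : ℝ) * cu i * y ^ (e + q)) / (au i * y ^ e + bu i * y ^ (e + p) + cu i * y ^ (e + q))) x) :
    (∑ j, ((p : ℝ) * bs j * x ^ (e + p) + (q : ℝ) * cs j * x ^ (e + q)) / (as j * x ^ e + bs j * x ^ (e + p) + cs j * x ^ (e + q))) ^ 2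
      ≤ (M : ℝ) * k * ((q : ℝ) * (q - 4 * p) / 4) := by
  have h := upCrossing_budget k M e p q hpq as bs cs au bu cu hx hsw hun hub huc hzero hup
  refine h.trans ?_
  rw [mul_assoc]
  refine mul_le_mul_of_nonneg_left ?_ (Nat.cast_nonneg M)
  calc ∑ j, ((((p : ℝ) * bs j * x ^ (e + p) + (q : ℝ) * cs j * x ^ (e + q)) / (as j * x ^ e + bs j * x ^ (e + p) + cs j * x ^ (e + q)) - p)
          * (q - ((p : ℝ) * bs j * x ^ (e + p) + (q : ℝ) * cs j * x ^ (e + q)) / (as j * x ^ e + bs j * x ^ (e + p) + cs j * x ^ (e + q)))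
        - p * (((p : ℝ) * bs j * x ^ (e + p) + (q : ℝ) * cs j * x ^ (e + q)) / (as j * x ^ e + bs j * x ^ (e + p) + cs j * x ^ (e + q))))
      ≤ ∑ _j : Fin k, (q : ℝ) * (q - 4 * p) / 4 := Finset.sum_le_sum fun j _ => riser_slack_le _ _ _
    _ = (k : ℝ) * ((q : ℝ) * (q - 4 * p) / 4) := by simp

/-- ★ **NO UP-CROSSING IN THE TAME WINDOW**: with `q ≤ 4p`, the hypotheses of `upCrossing_budget` force `Σ_j Φ_j(x) ≤ 0` — impossible as soon
as `k ≥ 1` (every switched ratio exceeds `p`).  So at `q ≤ 4p` the total Euler ratio crosses zero only DOWNWARDS on a zero-free interval: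
the tame theorem's mechanism as a statement about the sum. [this file's theorem] -/
theorem no_upCrossing_of_tame_window (k M : ℕ) (hk : 0 < k) (e p q : ℕ) (hp : 0 < p) (hpq : p ≤ q) (hwin : q ≤ 4 * p)
    (as bs cs : Fin k → ℝ) (au bu cu : Fin M → ℝ) {x : ℝ} (hx : 0 < x)
    (hsw : ∀ j, as j * (as j * x ^ e + bs j * x ^ (e + p) + cs j * x ^ (e + q)) < 0) (hsc : ∀ j, as j * cs j ≤ 0)
    (hun : ∀ i, 0 < au i * (au i * x ^ e + bu i * x ^ (e + p) + cu i * x ^ (e + q)))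
    (hub : ∀ i, au i * bu i ≤ 0) (huc : ∀ i, au i * cu i ≤ 0)
    (hzero : (∑ j, ((p : ℝ) * bs j * x ^ (e + p) + (q : ℝ) * cs j * x ^ (e + q)) / (as j * x ^ e + bs j * x ^ (e + p) + cs j * x ^ (e + q)))
      + (∑ i, ((p : ℝ) * bu i * x ^ (e + p) + (q : ℝ) * cu i * x ^ (e + q)) / (au i * x ^ e + bu i * x ^ (e + p) + cu i * x ^ (e + q))) = 0) :
    deriv (fun y : ℝ =>
      (∑ j, ((p : ℝ) * bs j * y ^ (e + p) + (q : ℝ) * cs j * y ^ (e + q)) / (as j * y ^ e + bs j * y ^ (e + p) + cs j * y ^ (e + q)))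
      + ∑ i, ((p : ℝ) * bu i * y ^ (e + p) + (q : ℝ) * cu i * y ^ (e + q)) / (au i * y ^ e + bu i * y ^ (e + p) + cu i * y ^ (e + q))) x < 0 := by
  by_contra hnot
  push Not at hnot
  have h := upCrossing_level_le k M e p q hpq as bs cs au bu cu hx hsw hun hub huc hzero hnot
  -- the right side is ≤ 0 in the window, the left side is a positive square
  have hq4 : (q : ℝ) * (q - 4 * p) / 4 ≤ 0 := by
    have : (q : ℝ) ≤ 4 * p := by exact_mod_cast hwin
    have hq0 : (0 : ℝ) ≤ q := Nat.cast_nonneg q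
    nlinarith
  have hrhs : (M : ℝ) * k * ((q : ℝ) * (q - 4 * p) / 4) ≤ 0 :=
    mul_nonpos_of_nonneg_of_nonpos (by positivity) hq4
  have hpos : 0 < ∑ j, ((p : ℝ) * bs j * x ^ (e + p) + (q : ℝ) * cs j * x ^ (e + q)) / (as j * x ^ e + bs j * x ^ (e + p) + cs j * x ^ (e + q)) := by
    refine Finset.sum_pos (fun j _ => ?_) ⟨⟨0, hk⟩, Finset.mem_univ _⟩
    have hpR : (0 : ℝ) < p := by exact_mod_cast hp
    exact hpR.trans (eulerRatio_gt_of_switched (as j) (bs j) (cs j) e p q hp hpq hx (hsc j) (hsw j))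
  nlinarith


/-- ★ **FEW PULLERS ⇒ NO UP-CROSSING**: if `M·q(q − 4p) < 4k·p²` (few unswitched factors relative to the switched ones — e.g. the last
components of a T5-all member), the total Euler ratio crosses zero only downwards (`k ≥ 1`; switched factors incoherent, `a c ≤ 0`).
[this file's theorem] -/
theorem no_upCrossing_of_few_pullers (k M : ℕ) (hk : 0 < k) (e p q : ℕ) (hp : 0 < p) (hpq : p ≤ q)
    (hfew : (M : ℝ) * ((q : ℝ) * (q - 4 * p)) < 4 * k * (p : ℝ) ^ 2)
    (as bs cs : Fin k → ℝ) (au bu cu : Fin M → ℝ) {x : ℝ} (hx : 0 < x)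
    (hsw : ∀ j, as j * (as j * x ^ e + bs j * x ^ (e + p) + cs j * x ^ (e + q)) < 0) (hsc : ∀ j, as j * cs j ≤ 0)
    (hun : ∀ i, 0 < au i * (au i * x ^ e + bu i * x ^ (e + p) + cu i * x ^ (e + q)))
    (hub : ∀ i, au i * bu i ≤ 0) (huc : ∀ i, au i * cu i ≤ 0)
    (hzero : (∑ j, ((p : ℝ) * bs j * x ^ (e + p) + (q : ℝ) * cs j * x ^ (e + q)) / (as j * x ^ e + bs j * x ^ (e + p) + cs j * x ^ (e + q)))
      + (∑ i, ((p : ℝ) * bu i * x ^ (e + p) + (q : ℝ) * cu i * x ^ (e + q)) / (au i * x ^ e + bu i * x ^ (e + p) + cu i * x ^ (e + q))) = 0) :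
    deriv (fun y : ℝ =>
      (∑ j, ((p : ℝ) * bs j * y ^ (e + p) + (q : ℝ) * cs j * y ^ (e + q)) / (as j * y ^ e + bs j * y ^ (e + p) + cs j * y ^ (e + q)))
      + ∑ i, ((p : ℝ) * bu i * y ^ (e + p) + (q : ℝ) * cu i * y ^ (e + q)) / (au i * y ^ e + bu i * y ^ (e + p) + cu i * y ^ (e + q))) x < 0 := by
  by_contra hnot
  push Not at hnot
  have h := upCrossing_level_le k M e p q hpq as bs cs au bu cu hx hsw hun hub huc hzero hnot
  -- the switched sum exceeds `k·p`
  have hpR : (0 : ℝ) < p := by exact_mod_cast hp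
  have hge : (k : ℝ) * p ≤ ∑ j, ((p : ℝ) * bs j * x ^ (e + p) + (q : ℝ) * cs j * x ^ (e + q))
      / (as j * x ^ e + bs j * x ^ (e + p) + cs j * x ^ (e + q)) := by
    have : ∑ _j : Fin k, (p : ℝ) ≤ ∑ j, ((p : ℝ) * bs j * x ^ (e + p) + (q : ℝ) * cs j * x ^ (e + q))
        / (as j * x ^ e + bs j * x ^ (e + p) + cs j * x ^ (e + q)) :=
      Finset.sum_le_sum fun j _ => (eulerRatio_gt_of_switched (as j) (bs j) (cs j) e p q hp hpq hx (hsc j) (hsw j)).le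
    simpa using this
  have hkp : 0 < (k : ℝ) * p := mul_pos (by exact_mod_cast hk) hpR
  -- square and compare
  have hsq : ((k : ℝ) * p) ^ 2 ≤ (M : ℝ) * k * ((q : ℝ) * (q - 4 * p) / 4) :=
    (pow_le_pow_left₀ hkp.le hge 2).trans h
  have hkR : (0 : ℝ) < k := by exact_mod_cast hk
  nlinarith

/-- **A switched factor RISES only inside the band `p < Φ < q`** (`0 < p ≤ q`): if its Euler ratio has a nonnegative derivative at `x`
then `p < Φ(x) < q` (the drag is negative). [this file's theorem] -/
theorem eulerRatio_mem_band_of_rising (a b c : ℝ) (e p q : ℕ) (hp : 0 < p) (hpq : p ≤ q) {x : ℝ} (hx : 0 < x)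
    (hsw : a * (a * x ^ e + b * x ^ (e + p) + c * x ^ (e + q)) < 0)
    (hrise : 0 ≤ deriv (fun y : ℝ => ((p : ℝ) * b * y ^ (e + p) + (q : ℝ) * c * y ^ (e + q))
      / (a * y ^ e + b * y ^ (e + p) + c * y ^ (e + q))) x) :
    (p : ℝ) < ((p : ℝ) * b * x ^ (e + p) + (q : ℝ) * c * x ^ (e + q)) / (a * x ^ e + b * x ^ (e + p) + c * x ^ (e + q)) ∧
    ((p : ℝ) * b * x ^ (e + p) + (q : ℝ) * c * x ^ (e + q)) / (a * x ^ e + b * x ^ (e + p) + c * x ^ (e + q)) < q := by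
  set F := a * x ^ e + b * x ^ (e + p) + c * x ^ (e + q) with hF
  set Φ := ((p : ℝ) * b * x ^ (e + p) + (q : ℝ) * c * x ^ (e + q)) / F with hΦ
  have hF0 : F ≠ 0 := by intro h; rw [h, mul_zero] at hsw; exact lt_irrefl 0 hsw
  have hD := hasDerivAt_eulerRatio a b c e p q hx hF0
  rw [hD.deriv] at hrise
  have hpR : (0 : ℝ) < p := by exact_mod_cast hp
  have hqR : (0 : ℝ) < q := by exact_mod_cast lt_of_lt_of_le hp hpq
  -- the drag is strictly negative
  have hdrag : (p : ℝ) * q * (a * x ^ e / F) < 0 := by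
    have h1 : a * x ^ e / F = (a * F) * x ^ e / F ^ 2 := by field_simp
    have h2 : (a * F) * x ^ e / F ^ 2 < 0 :=
      div_neg_of_neg_of_pos (mul_neg_of_neg_of_pos hsw (pow_pos hx e)) (by positivity)
    rw [h1]
    exact mul_neg_of_pos_of_neg (mul_pos hpR hqR) h2
  have hnum : 0 ≤ (Φ - p) * (q - Φ) + (p : ℝ) * q * (a * x ^ e / F) := by
    have := mul_nonneg hrise hx.le
    rwa [div_mul_cancel₀ _ hx.ne'] at this
  have hpos : 0 < (Φ - p) * (q - Φ) := by linarith
  -- a positive product of `Φ − p` and `q − Φ` with `p ≤ q` forces both positive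
  have hpq' : (p : ℝ) ≤ q := by exact_mod_cast hpq
  constructor
  · by_contra hle; push Not at hle
    have : (Φ - p) * (q - Φ) ≤ 0 := mul_nonpos_of_nonpos_of_nonneg (by linarith) (by linarith)
    linarith
  · by_contra hge; push Not at hge
    have : (Φ - p) * (q - Φ) ≤ 0 := mul_nonpos_of_nonneg_of_nonpos (by linarith) (by linarith)
    linarith


/-! ### Bridge to the line's `Fin 3` supports -/

/-- A strictly increasing `d : Fin 3 → ℕ` is the literal support `![d 0, d 0 + (d 1 − d 0), d 0 + (d 2 − d 0)]`. [folklore] -/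
theorem fin3_support_eq (d : Fin 3 → ℕ) (h01 : d 0 < d 1) (h12 : d 1 < d 2) :
    (![d 0, d 0 + (d 1 - d 0), d 0 + (d 2 - d 0)] : Fin 3 → ℕ) = d := by
  funext l
  fin_cases l
  · rfl
  · show d 0 + (d 1 - d 0) = d 1; omega
  · show d 0 + (d 2 - d 0) = d 2; omega

/-- ★ **No Euler zero where every factor is switched — line shape** (`d 0 < d 1 < d 2`, `m ≥ 1`, factors with `a_{j0} a_{j2} ≤ 0` and
`a_{j0}·f_j(x) < 0`): `(eulerNumerator d a 0)(x) ≠ 0`. [this file's theorem] -/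
theorem eulerNumerator_eval_ne_zero_of_all_switched' {m : ℕ} (hm : 0 < m) (d : Fin 3 → ℕ) (h01 : d 0 < d 1) (h12 : d 1 < d 2)
    (a : Fin m → Fin 3 → ℝ) {x : ℝ} (hx : 0 < x) (hac : ∀ j, a j 0 * a j 2 ≤ 0)
    (hsw : ∀ j, a j 0 * (∑ l, C (a j l) * X ^ (d l) : ℝ[X]).eval x < 0) :
    (∑ j, (∑ l, C (a j l * ((d l : ℝ) - d 0)) * X ^ (d l)) * ∏ i ∈ Finset.univ.erase j, (∑ l, C (a i l) * X ^ (d l))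
      : ℝ[X]).eval x ≠ 0 := by
  have hp : 0 < d 1 - d 0 := by omega
  have hpq : d 1 - d 0 ≤ d 2 - d 0 := by omega
  have hsw' : ∀ j, a j 0 * (a j 0 * x ^ (d 0) + a j 1 * x ^ (d 0 + (d 1 - d 0)) + a j 2 * x ^ (d 0 + (d 2 - d 0))) < 0 := by
    intro j
    have h := (eval_trinomial_three (d 0) (d 1 - d 0) (d 2 - d 0) (a j) x).1
    rw [fin3_support_eq d h01 h12] at h
    rw [← h]; exact hsw j
  have h := eulerNumerator_eval_ne_zero_of_all_switched hm (d 0) (d 1 - d 0) (d 2 - d 0) hp hpq a hx hac hsw'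
  rw [fin3_support_eq d h01 h12] at h
  simpa using h

/-- ★ **No Euler zero where every factor is unswitched — line shape** (`d 0 < d 1 < d 2`, factors with `a_{j0} a_{j1} ≤ 0`, `a_{j0} a_{j2} ≤ 0`,
`a_{j0}·f_j(x) > 0`, one of them not a bottom monomial): `(eulerNumerator d a 0)(x) ≠ 0`. [this file's theorem] -/
theorem eulerNumerator_eval_ne_zero_of_all_unswitched' {m : ℕ} (d : Fin 3 → ℕ) (h01 : d 0 < d 1) (h12 : d 1 < d 2)
    (a : Fin m → Fin 3 → ℝ) {x : ℝ} (hx : 0 < x) (hab : ∀ j, a j 0 * a j 1 ≤ 0) (hac : ∀ j, a j 0 * a j 2 ≤ 0)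
    (hun : ∀ j, 0 < a j 0 * (∑ l, C (a j l) * X ^ (d l) : ℝ[X]).eval x) (hnd : ∃ j, a j 1 ≠ 0 ∨ a j 2 ≠ 0) :
    (∑ j, (∑ l, C (a j l * ((d l : ℝ) - d 0)) * X ^ (d l)) * ∏ i ∈ Finset.univ.erase j, (∑ l, C (a i l) * X ^ (d l))
      : ℝ[X]).eval x ≠ 0 := by
  have hp : 0 < d 1 - d 0 := by omega
  have hpq : d 1 - d 0 ≤ d 2 - d 0 := by omega
  have hun' : ∀ j, 0 < a j 0 * (a j 0 * x ^ (d 0) + a j 1 * x ^ (d 0 + (d 1 - d 0)) + a j 2 * x ^ (d 0 + (d 2 - d 0))) := by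
    intro j
    have h := (eval_trinomial_three (d 0) (d 1 - d 0) (d 2 - d 0) (a j) x).1
    rw [fin3_support_eq d h01 h12] at h
    rw [← h]; exact hun j
  have h := eulerNumerator_eval_ne_zero_of_all_unswitched (d 0) (d 1 - d 0) (d 2 - d 0) hp hpq a hx hab hac hun' hnd
  rw [fin3_support_eq d h01 h12] at h
  simpa using h

end ProductPlusOne

end Summit.ValiantsHypothesis.ValiantsHypothesis.Theorems.LacunarySymmetroidMatrixDescartes
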